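import Literature.AnabelianGeometry.EtaleTheta.TemperedFrobenioidCor38SubPreStepsBaseFS
import Literature.AnabelianGeometry.EtaleTheta.TemperedFrobenioidCor38SubOTriDegreeAll
import HarnessLib

/-!
# [EtTh] Cor. 3.8 proof row C38-L02a `PreservesPreSteps` (F-2809): the row HOLDS for every record whose pre-steps
# have PARTNERS — in particular whenever the principal divisors are cofinal — over bases with monic endomorphisms

S. Mochizuki, *The étale theta function and its Frobenioid-theoretic manifestations*, Publ. RIMS **45** (2009)
[EtTh], Cor. 3.8, proof, PDF p. 81 l. 2–3: "In particular, by [Mzk17], Theorem 3.4, (ii) … it follows that `Ψ`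
preserves pre-steps" [cite: MochizukiEtTh2009, Cor 3.8 p.81]; S. Mochizuki, *The geometry of Frobenioids I*,
Kyushu J. Math. **62** (2008) [FrdI], §0 pp. 15–18 (totally epimorphic categories: "if `α ∘ β` is an isomorphism,
then `α`, `β` are isomorphisms"; FSM-morphisms; categories of FSMFF-type), Def. 1.2 (ii)–(iii) p. 22 (`O^▷(A)`,
pre-steps), Thm. 5.2 (i) p. 100 (model Frobenioids) [cite: MochizukiFrdI2008, Thm. 5.2(i) p.100].

abc-iut cell, block F, seat abc-iut-f-109 (gen 3).  PROOF-ONLY file (0 definitions), a HAND for the decision lease on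
the bare universal closure of `Cor38Hyp.PreservesPreSteps` (FACT-LIST F-2809; abc-iut-f-032 g7).  It ASSEMBLES two
kernel constraints of record that hold for EVERY `h : Cor38Hyp C₁ C₂` —
* the DEGREE half on `O^▷(−)` at every object (abc-iut-f-146, `TemperedFrobenioidCor38SubOTriDegreeAll.lean`:
  `Cor38Hyp.isLinear_map_of_mem_endSubmonoid_all`, "perfect powers"), and
* the BASE half up to fiberwise-surjectivity (abc-iut-w6-d057, `TemperedFrobenioidCor38SubPreStepsBaseFS.lean`:
  `Cor38Hyp.isFiberwiseSurjective_baseMap_map_of_isPreStep`, plus [FrdI] §0 p. 18 "FSM endomorphisms of a category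
  of FSMFF-type are invertible", `IsOfFSMFFType.isIso_of_isFSM_of_isEndomorphism`, which USES `Cor38Hyp.fsmff`) —
into a CLOSER of the row on an honest class, by one elementary device: **partners**.  A pre-step `φ : X → Y` has a
*partner* if there is a pre-step `ψ : Y → X` with `Base(ψ ∘ φ) = id`; then `ψ ∘ φ ∈ O^▷(X)`, so
`deg_Fr(Ψ(ψ ∘ φ)) = 1` and `Base(Ψ(ψ ∘ φ)) = Base(Ψψ) ∘ Base(Ψφ)` is a fiberwise-surjective ENDOmorphism of
`Base(Ψ X)`; if endomorphisms in `D₂` are monomorphisms it is FSM, hence invertible (`D₂` of FSMFF-type), and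
then `Base(Ψ φ)` is invertible because `D₂` is totally epimorphic ([FrdI] §0 p. 16) and `deg_Fr(Ψ φ) = 1`
because degrees multiply in `ℕ_{≥1}`.  WHAT IS PROVED:
* `Cor38Hyp.isLinear_map_of_partner` (no hypothesis on the bases), `Cor38Hyp.isBaseIso_map_of_partner`,
  `Cor38Hyp.isPreStep_map_of_partner` (+ the `Ψ⁻¹` mirrors): for EVERY record, `Ψ` carries every partnered
  pre-step to a pre-step, provided the endomorphisms in the target base are monomorphisms;
* `Cor38Hyp.preservesPreSteps_of_partners`: **row C38-L02a for every record all of whose pre-steps (both sides)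
  have partners, over bases whose endomorphisms are monomorphisms** (thin bases; `SingleObj` of a cancellative
  monoid such as `Aff⁺(ℤ)` or a free monoid — the bases of every separating-model attempt of record);
* partners come for free from COFINALITY of the principal divisors ("every divisor class `g ∈ Φ(A)^gp` is
  dominated by a principal divisor: `Div_B(u) = g + m`, `m ∈ Φ(A)`" — true when every effective divisor divides an
  effective principal one; `TemperedFrobenioid.exists_partner_of_cofinal`, the partner of `(1, f, Z, u)` being
  `(1, f⁻¹, m, u')` with `Div_B(u') = ((f⁻¹)^*α)⁻¹ · β · m`), whence
  **`Cor38Hyp.preservesPreSteps_of_cofinal`** and its thin-base instance `…_of_cofinal_of_thin`.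
READING (cell rule R5; the FACT-LIST label of F-2809 is NOT moved by this file): the bare closure remains
undecided; what the kernel now says about a would-be separating record `h` is sharper — it must move a pre-step
WITHOUT partner (a zero divisor that divides no effective principal divisor: "poor" rational functions, objects
that are not linked back), or the image must sit over a base object carrying a NON-MONIC endomorphism; the degree of
a partnered pre-step can never move.  No [FrdI] Thm. 3.4 input; no Frobenioid axiom; vocabulary clauses untouched.
HONEST FRAMING: bookkeeping about OUR typed Def. 3.6 interface (print's Cor. 3.8 quotes [FrdI] Thm. 3.4 (ii) for
genuine Frobenioids); nothing here bears on [IUTchIII] Cor. 3.12; no side taken; typed ≠ proved.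
-/

namespace Literature.AnabelianGeometry.EtaleTheta

open CategoryTheory Opposite Literature.AlgebraicGeometry.Frobenioids

universe u₀ v₀ u v w

variable {D₀ : Type u₀} [Category.{v₀} D₀] {V : FrdIMonoidStub.{w}} {T : RealifiedDivisorMonoids (D₀ := D₀) V}
  {D : Type u} [Category.{v} D] {VD : FrdICatStub.{u, v, w} D}

/-! ## §1 Tempered Frobenioids: partners, and partners from cofinal principal divisors -/

namespace TemperedFrobenioid

variable (C : TemperedFrobenioid T D VD)

/-- Pre-steps of the Frobenioid of a tempered Frobenioid ([FrdI] Def. 1.2 (iii) through the model structure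
`C → F_Φ`): Frobenius degree `1` and invertible `Base`. (bookkeeping) [cite: MochizukiEtTh2009, Def 3.6 p.77] -/
theorem opsData_isPreStep_iff {X Y : C.category} (φ : X ⟶ Y) :
    C.opsData.IsPreStep φ ↔ ModelFrobenioid.degFr φ = 1 ∧ IsIso (ModelFrobenioid.baseMap φ) :=
  Iff.rfl

/-- The composite of two linear morphisms `φ : X → Y`, `ψ : Y → X` with `Base(ψ ∘ φ) = id` lies in `O^▷(X)`
([FrdI] Def. 1.2 (ii)). [cite: MochizukiFrdI2008, Def. 1.2 (ii) p.22] -/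
theorem comp_mem_endSubmonoid {X Y : C.category} (φ : X ⟶ Y) (ψ : Y ⟶ X)
    (hφ : ModelFrobenioid.degFr φ = 1) (hψ : ModelFrobenioid.degFr ψ = 1)
    (hb : ModelFrobenioid.baseMap (φ ≫ ψ) = 𝟙 X.base) :
    (φ ≫ ψ : End X) ∈ C.opsData.endSubmonoid X := by
  refine ⟨hb, ?_⟩
  change ModelFrobenioid.degFr (φ ≫ ψ) = 1
  rw [ModelFrobenioid.degFr_comp, hφ, hψ, mul_one]

/-- Cofinality of the principal divisors ("every class `g ∈ Φ(A)^gp` is dominated by a principal divisor,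
`Div_B(u) = g · m` with `m ∈ Φ(A)`"), stated with the tempered Frobenioid's own `Div_B : B(A) → Φ(A)^gp`
(`TemperedFrobenioid.divB`, Def. 3.6 (ii) data), implies the same statement read through the model-Frobenioid
packaging `(Φ, B, Div_B) = (divisorMonoid, ratFnFunctor, divBNatTrans)` used below (the two agree definitionally).
(bookkeeping) [cite: MochizukiEtTh2009, Def 3.6 p.77] -/
theorem cofinal_model_of_cofinal
    (hcof : ∀ (A : Dᵒᵖ) (g : Algebra.GrothendieckGroup (C.Φ.carrier A)),
      ∃ (u : C.ratFn A) (m : C.Φ.carrier A), C.divB A u = g * Algebra.GrothendieckGroup.of m)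
    (A : Dᵒᵖ) (g : Algebra.GrothendieckGroup (C.divisorMonoid.obj A)) :
    ∃ (u : C.ratFnFunctor.obj A) (m : C.divisorMonoid.obj A),
      Literature.AlgebraicGeometry.Frobenioids.divB C.divisorMonoid C.ratFnFunctor C.divBNatTrans A u =
        g * Algebra.GrothendieckGroup.of m := by
  obtain ⟨u, m, hu⟩ := hcof A g
  exact ⟨u, m, hu⟩

/-- **Partners from cofinal principal divisors.**  If at every `A ∈ Ob(D)` every class `g ∈ Φ(A)^gp` is
dominated by a principal divisor (`Div_B(u) = g · m` with `m ∈ Φ(A)`), then every pre-step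
`φ = (1, f, Z, u) : X → Y` has a PARTNER: the pre-step `ψ = (1, f⁻¹, m, u') : Y → X` with `Base(ψ ∘ φ) = id`,
where `Div_B(u') = ((f⁻¹)^* α)⁻¹ · β · m`. [cite: MochizukiFrdI2008, Thm. 5.2(i) p.100] -/
theorem exists_partner_of_cofinal
    (hcof : ∀ (A : Dᵒᵖ) (g : Algebra.GrothendieckGroup (C.divisorMonoid.obj A)),
      ∃ (u : C.ratFnFunctor.obj A) (m : C.divisorMonoid.obj A),
        Literature.AlgebraicGeometry.Frobenioids.divB C.divisorMonoid C.ratFnFunctor C.divBNatTrans A u =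
          g * Algebra.GrothendieckGroup.of m)
    {X Y : C.category} (φ : X ⟶ Y) (hφ : C.opsData.IsPreStep φ) :
    ∃ ψ : Y ⟶ X, C.opsData.IsPreStep ψ ∧ ModelFrobenioid.baseMap (φ ≫ ψ) = 𝟙 X.base := by
  haveI : IsIso (ModelFrobenioid.baseMap φ) := hφ.2
  obtain ⟨u, m, hu⟩ := hcof (op Y.base)
    ((pullGp C.divisorMonoid (inv (ModelFrobenioid.baseMap φ)) X.cls)⁻¹ * Y.cls)
  refine ⟨{ degFr := 1
            base := inv (ModelFrobenioid.baseMap φ)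
            div := m
            unit := u
            rel := ?_ }, ⟨rfl, ?_⟩, ?_⟩
  · rw [PNat.one_coe, pow_one, hu, ← mul_assoc, mul_inv_cancel_left]
  · change IsIso (inv (ModelFrobenioid.baseMap φ))
    infer_instance
  · change ModelFrobenioid.baseMap φ ≫ inv (ModelFrobenioid.baseMap φ) = 𝟙 X.base
    exact IsIso.hom_inv_id _

/-- Under the same cofinality, every object `(A_D, α)` carries a base-identity endomorphism of Frobenius degree
`2`, namely `(2, id, m, u)` with `Div_B(u) = α · m` (not needed below — the degree half holds at every object by
`TemperedFrobenioidCor38SubOTriDegreeAll` — recorded for the census: such objects are never "effective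
anchors"). [cite: MochizukiFrdI2008, Thm. 5.2(i) p.100] -/
theorem exists_isBaseIdentity_degFr_two_of_cofinal
    (hcof : ∀ (A : Dᵒᵖ) (g : Algebra.GrothendieckGroup (C.divisorMonoid.obj A)),
      ∃ (u : C.ratFnFunctor.obj A) (m : C.divisorMonoid.obj A),
        Literature.AlgebraicGeometry.Frobenioids.divB C.divisorMonoid C.ratFnFunctor C.divBNatTrans A u =
          g * Algebra.GrothendieckGroup.of m)
    (X : C.category) :
    ∃ x : X ⟶ X, C.opsData.IsBaseIdentity x ∧ C.opsData.degFr x = 2 := by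
  obtain ⟨u, m, hu⟩ := hcof (op X.base) X.cls
  refine ⟨{ degFr := 2
            base := 𝟙 X.base
            div := m
            unit := u
            rel := ?_ }, rfl, rfl⟩
  rw [pullGp_id, hu, ← mul_assoc, ← pow_two]
  rfl

end TemperedFrobenioid

/-! ## §2 The row C38-L02a for partnered pre-steps, for EVERY record `h : Cor38Hyp C₁ C₂` -/

section Rows

variable {D₀' : Type u₀} [Category.{v₀} D₀'] {T' : RealifiedDivisorMonoids (D₀ := D₀') V}
  {D' : Type u} [Category.{v} D'] {VD' : FrdICatStub.{u, v, w} D'}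
  {C₁ : TemperedFrobenioid T D VD} {C₂ : TemperedFrobenioid T' D' VD'}

namespace Cor38Hyp

variable (h : Cor38Hyp C₁ C₂)

/-- **Degree half for partnered pre-steps, for EVERY record (no hypothesis on the bases)**: if the linear
morphism `φ : X → Y` has a linear `ψ : Y → X` with `Base(ψ ∘ φ) = id`, then `deg_Fr(Ψ φ) = 1` — because
`ψ ∘ φ ∈ O^▷(X)` is carried to a linear endomorphism (abc-iut-f-146's degree rigidity at every object) and
degrees multiply in `ℕ_{≥1}`. [cite: MochizukiEtTh2009, Cor 3.8 p.81] -/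
theorem isLinear_map_of_partner {X Y : C₁.category} (φ : X ⟶ Y) (ψ : Y ⟶ X)
    (hφ : ModelFrobenioid.degFr φ = 1) (hψ : ModelFrobenioid.degFr ψ = 1)
    (hb : ModelFrobenioid.baseMap (φ ≫ ψ) = 𝟙 X.base) :
    C₂.opsData.IsLinear (h.Ψ.functor.map φ) := by
  have ht : ModelFrobenioid.degFr (h.Ψ.functor.map (φ ≫ ψ)) = 1 :=
    h.isLinear_map_of_mem_endSubmonoid_all (C₁.comp_mem_endSubmonoid φ ψ hφ hψ hb)
  rw [h.Ψ.functor.map_comp, ModelFrobenioid.degFr_comp] at ht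
  have hnat : (ModelFrobenioid.degFr (h.Ψ.functor.map ψ) : ℕ) *
      (ModelFrobenioid.degFr (h.Ψ.functor.map φ) : ℕ) = 1 := by
    exact_mod_cast congrArg PNat.val ht
  exact PNat.coe_inj.mp (by simpa using Nat.eq_one_of_mul_eq_one_left hnat)

/-- The mirror for `Ψ⁻¹`. [cite: MochizukiEtTh2009, Cor 3.8 p.81] -/
theorem isLinear_inverse_map_of_partner {X Y : C₂.category} (φ : X ⟶ Y) (ψ : Y ⟶ X)
    (hφ : ModelFrobenioid.degFr φ = 1) (hψ : ModelFrobenioid.degFr ψ = 1)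
    (hb : ModelFrobenioid.baseMap (φ ≫ ψ) = 𝟙 X.base) :
    C₁.opsData.IsLinear (h.Ψ.inverse.map φ) := by
  have ht : ModelFrobenioid.degFr (h.Ψ.inverse.map (φ ≫ ψ)) = 1 :=
    h.isLinear_inverse_map_of_mem_endSubmonoid_all (C₂.comp_mem_endSubmonoid φ ψ hφ hψ hb)
  rw [h.Ψ.inverse.map_comp, ModelFrobenioid.degFr_comp] at ht
  have hnat : (ModelFrobenioid.degFr (h.Ψ.inverse.map ψ) : ℕ) *
      (ModelFrobenioid.degFr (h.Ψ.inverse.map φ) : ℕ) = 1 := by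
    exact_mod_cast congrArg PNat.val ht
  exact PNat.coe_inj.mp (by simpa using Nat.eq_one_of_mul_eq_one_left hnat)

/-- **Base half for partnered pre-steps, USING `Cor38Hyp.fsmff`**: if the pre-step `φ : X → Y` has a partner
`ψ` (`Base(ψ ∘ φ) = id`) and every endomorphism of `Base(Ψ X)` in `D₂` is a monomorphism, then `Base(Ψ φ)` is
invertible: `Base(Ψ(ψ ∘ φ))` is a fiberwise-surjective (abc-iut-w6-d057) monic endomorphism, i.e. FSM, hence
invertible in the FSMFF category `D₂` ([FrdI] §0 p. 18), and `D₂` is totally epimorphic ([FrdI] §0 p. 16).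
[cite: MochizukiEtTh2009, Cor 3.8 p.81] -/
theorem isBaseIso_map_of_partner {X Y : C₁.category} (φ : X ⟶ Y) (ψ : Y ⟶ X)
    (hφ : ModelFrobenioid.degFr φ = 1) (hψ : ModelFrobenioid.degFr ψ = 1)
    (hb : ModelFrobenioid.baseMap (φ ≫ ψ) = 𝟙 X.base)
    (hm : ∀ e : (h.Ψ.functor.obj X).base ⟶ (h.Ψ.functor.obj X).base, Mono e) :
    IsIso (ModelFrobenioid.baseMap (h.Ψ.functor.map φ)) := by
  have hpre : C₁.opsData.IsPreStep (φ ≫ ψ) := by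
    refine ⟨?_, ?_⟩
    · change ModelFrobenioid.degFr (φ ≫ ψ) = 1
      rw [ModelFrobenioid.degFr_comp, hφ, hψ, mul_one]
    · change IsIso (ModelFrobenioid.baseMap (φ ≫ ψ))
      rw [hb]
      infer_instance
  have hFS := h.isFiberwiseSurjective_baseMap_map_of_isPreStep (φ ≫ ψ) hpre
  rw [h.Ψ.functor.map_comp, ModelFrobenioid.baseMap_comp] at hFS
  haveI : IsIso (ModelFrobenioid.baseMap (h.Ψ.functor.map φ) ≫ ModelFrobenioid.baseMap (h.Ψ.functor.map ψ)) :=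
    h.fsmff.2.isIso_of_isFSM_of_isEndomorphism _ ⟨hFS, hm _⟩
  exact (C₂.isTotallyEpimorphic.isIso_of_isIso_comp (ModelFrobenioid.baseMap (h.Ψ.functor.map φ))
    (ModelFrobenioid.baseMap (h.Ψ.functor.map ψ))).2

/-- The mirror for `Ψ⁻¹` (monic endomorphisms of `Base(Ψ⁻¹ X)` in `D₁`). [cite: MochizukiEtTh2009, Cor 3.8 p.81] -/
theorem isBaseIso_inverse_map_of_partner {X Y : C₂.category} (φ : X ⟶ Y) (ψ : Y ⟶ X)
    (hφ : ModelFrobenioid.degFr φ = 1) (hψ : ModelFrobenioid.degFr ψ = 1)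
    (hb : ModelFrobenioid.baseMap (φ ≫ ψ) = 𝟙 X.base)
    (hm : ∀ e : (h.Ψ.inverse.obj X).base ⟶ (h.Ψ.inverse.obj X).base, Mono e) :
    IsIso (ModelFrobenioid.baseMap (h.Ψ.inverse.map φ)) := by
  have hpre : C₂.opsData.IsPreStep (φ ≫ ψ) := by
    refine ⟨?_, ?_⟩
    · change ModelFrobenioid.degFr (φ ≫ ψ) = 1
      rw [ModelFrobenioid.degFr_comp, hφ, hψ, mul_one]
    · change IsIso (ModelFrobenioid.baseMap (φ ≫ ψ))
      rw [hb]
      infer_instance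
  have hFS := h.isFiberwiseSurjective_baseMap_inverse_map_of_isPreStep (φ ≫ ψ) hpre
  rw [h.Ψ.inverse.map_comp, ModelFrobenioid.baseMap_comp] at hFS
  haveI : IsIso (ModelFrobenioid.baseMap (h.Ψ.inverse.map φ) ≫ ModelFrobenioid.baseMap (h.Ψ.inverse.map ψ)) :=
    h.fsmff.1.isIso_of_isFSM_of_isEndomorphism _ ⟨hFS, hm _⟩
  exact (C₁.isTotallyEpimorphic.isIso_of_isIso_comp (ModelFrobenioid.baseMap (h.Ψ.inverse.map φ))
    (ModelFrobenioid.baseMap (h.Ψ.inverse.map ψ))).2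

/-- **`Ψ` carries every PARTNERED pre-step to a pre-step, for EVERY record `h`**, provided the endomorphisms of
`Base(Ψ X)` in `D₂` are monomorphisms. [cite: MochizukiEtTh2009, Cor 3.8 p.81] -/
theorem isPreStep_map_of_partner {X Y : C₁.category} (φ : X ⟶ Y) (ψ : Y ⟶ X)
    (hφ : C₁.opsData.IsPreStep φ) (hψ : C₁.opsData.IsPreStep ψ)
    (hb : ModelFrobenioid.baseMap (φ ≫ ψ) = 𝟙 X.base)
    (hm : ∀ e : (h.Ψ.functor.obj X).base ⟶ (h.Ψ.functor.obj X).base, Mono e) :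
    C₂.opsData.IsPreStep (h.Ψ.functor.map φ) :=
  ⟨h.isLinear_map_of_partner φ ψ hφ.1 hψ.1 hb, h.isBaseIso_map_of_partner φ ψ hφ.1 hψ.1 hb hm⟩

/-- The mirror for `Ψ⁻¹`. [cite: MochizukiEtTh2009, Cor 3.8 p.81] -/
theorem isPreStep_inverse_map_of_partner {X Y : C₂.category} (φ : X ⟶ Y) (ψ : Y ⟶ X)
    (hφ : C₂.opsData.IsPreStep φ) (hψ : C₂.opsData.IsPreStep ψ)
    (hb : ModelFrobenioid.baseMap (φ ≫ ψ) = 𝟙 X.base)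
    (hm : ∀ e : (h.Ψ.inverse.obj X).base ⟶ (h.Ψ.inverse.obj X).base, Mono e) :
    C₁.opsData.IsPreStep (h.Ψ.inverse.map φ) :=
  ⟨h.isLinear_inverse_map_of_partner φ ψ hφ.1 hψ.1 hb, h.isBaseIso_inverse_map_of_partner φ ψ hφ.1 hψ.1 hb hm⟩

/-- **Row C38-L02a (F-2809) on the partnered class, for EVERY record**: if every pre-step of `C₁` and of `C₂`
has a partner and the endomorphisms in `D₁`, `D₂` are monomorphisms, then `Ψ` and `Ψ⁻¹` preserve pre-steps.
Uses `Cor38Hyp.fsmff` (necessarily: abc-iut-f-032's `ConeTwist.preservesPreSteps_shape_false_without_fsmff`).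
[cite: MochizukiEtTh2009, Cor 3.8 p.81] -/
theorem preservesPreSteps_of_partners
    (hm : ∀ (a : D) (e : a ⟶ a), Mono e) (hm' : ∀ (a : D') (e : a ⟶ a), Mono e)
    (hP₁ : ∀ ⦃X Y : C₁.category⦄ (φ : X ⟶ Y), C₁.opsData.IsPreStep φ →
      ∃ ψ : Y ⟶ X, C₁.opsData.IsPreStep ψ ∧ ModelFrobenioid.baseMap (φ ≫ ψ) = 𝟙 X.base)
    (hP₂ : ∀ ⦃X Y : C₂.category⦄ (φ : X ⟶ Y), C₂.opsData.IsPreStep φ →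
      ∃ ψ : Y ⟶ X, C₂.opsData.IsPreStep ψ ∧ ModelFrobenioid.baseMap (φ ≫ ψ) = 𝟙 X.base) :
    h.PreservesPreSteps := by
  refine ⟨fun X Y φ hφ => ?_, fun X Y φ hφ => ?_⟩
  · obtain ⟨ψ, hψ, hb⟩ := hP₁ φ hφ
    exact h.isPreStep_map_of_partner φ ψ hφ hψ hb (hm' _)
  · obtain ⟨ψ, hψ, hb⟩ := hP₂ φ hφ
    exact h.isPreStep_inverse_map_of_partner φ ψ hφ hψ hb (hm _)

/-- **Row C38-L02a (F-2809) from COFINAL principal divisors, for EVERY record** over bases whose endomorphisms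
are monomorphisms: if on both sides every divisor class is dominated by a principal divisor, then `Ψ` and `Ψ⁻¹`
preserve pre-steps. [cite: MochizukiEtTh2009, Cor 3.8 p.81] -/
theorem preservesPreSteps_of_cofinal
    (hm : ∀ (a : D) (e : a ⟶ a), Mono e) (hm' : ∀ (a : D') (e : a ⟶ a), Mono e)
    (hcof₁ : ∀ (A : Dᵒᵖ) (g : Algebra.GrothendieckGroup (C₁.Φ.carrier A)),
      ∃ (u : C₁.ratFn A) (m : C₁.Φ.carrier A), C₁.divB A u = g * Algebra.GrothendieckGroup.of m)
    (hcof₂ : ∀ (A : D'ᵒᵖ) (g : Algebra.GrothendieckGroup (C₂.Φ.carrier A)),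
      ∃ (u : C₂.ratFn A) (m : C₂.Φ.carrier A), C₂.divB A u = g * Algebra.GrothendieckGroup.of m) :
    h.PreservesPreSteps :=
  h.preservesPreSteps_of_partners hm hm'
    (fun _ _ φ hφ => C₁.exists_partner_of_cofinal (C₁.cofinal_model_of_cofinal hcof₁) φ hφ)
    (fun _ _ φ hφ => C₂.exists_partner_of_cofinal (C₂.cofinal_model_of_cofinal hcof₂) φ hφ)

/-- **Thin-base instance**: over thin bases `D₁`, `D₂` (every hom-type a subsingleton — points, preorders such as
the walking arrow or `(ℕ, ≥)`, the discrete bases of the cell's toys) cofinal principal divisors on both sides give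
row C38-L02a for EVERY record. [cite: MochizukiEtTh2009, Cor 3.8 p.81] -/
theorem preservesPreSteps_of_cofinal_of_thin [Quiver.IsThin D] [Quiver.IsThin D']
    (hcof₁ : ∀ (A : Dᵒᵖ) (g : Algebra.GrothendieckGroup (C₁.Φ.carrier A)),
      ∃ (u : C₁.ratFn A) (m : C₁.Φ.carrier A), C₁.divB A u = g * Algebra.GrothendieckGroup.of m)
    (hcof₂ : ∀ (A : D'ᵒᵖ) (g : Algebra.GrothendieckGroup (C₂.Φ.carrier A)),
      ∃ (u : C₂.ratFn A) (m : C₂.Φ.carrier A), C₂.divB A u = g * Algebra.GrothendieckGroup.of m) :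
    h.PreservesPreSteps :=
  h.preservesPreSteps_of_cofinal (fun _ _ => ⟨fun _ _ _ => Subsingleton.elim _ _⟩)
    (fun _ _ => ⟨fun _ _ _ => Subsingleton.elim _ _⟩) hcof₁ hcof₂

end Cor38Hyp

end Rows

end Literature.AnabelianGeometry.EtaleTheta
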